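import Summits.Parity.GeneralizedHardyLittlewood.Theorems.LiouvilleShiftedTablesEngineToPairsTIOfBV

/-!
# Type-I budget from `BVLiouville` (stub `stub_TI_of_BV` of line `Sketch`, crux `EngineToPairs`), part 2:
# multiplicity of `d = qm`, Cauchy–Schwarz, one application of `BVLiouville`

This file proves the registered stub `stub_TI_of_BV : BVLiouville → TIBudget` of the skeleton of line
`Sketch` (stmt-Parity-14659; vocabulary `Theorems/LiouvilleShiftedTablesEngineToPairsDefs.lean`, part 1
`Theorems/LiouvilleShiftedTablesEngineToPairsTIOfBV.lean`).

By part 1, for `q ∈ moduliH h (x^{ε₁})` and `1 ≤ m ≤ x^{1/2−2δ}` the inner Type-I sum of `shiftWeight h`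
is at most `2 G_x(qm) + 1`, where `G_x(d)` is the worst `λ`-sum along an initial segment of a progression
modulo `d` below `x` (`exists_worst`).  Regrouping by `d = qm ≤ x^{1/2−2δ+ε₁} ≤ x^{1/2−δ}` with the
multiplicity weight `ν(d) = ∑_{qm = d} τ(m)^B ≤ τ(d)^{B+1}` (`fiber_sum_tauPow_le`), Cauchy–Schwarz gives
`∑_d ν(d) G_x(d) ≤ (∑_d ν(d)² G_x(d))^{1/2} (∑_d G_x(d))^{1/2}`; the first factor is `≪ x (log x)^{c₁}` by
the trivial bound `G_x(d) ≤ x/d` and the divisor power sums of the tree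
(`Literature.NumberTheory.Sieve.exists_sum_sigma_zero_pow_div_le_real`), the second is
`≤ C x (log x)^{−2A−c₁}` by ONE application of `BVLiouville` (level `x^{1/2−δ}`) with the argmax residue
and height of each modulus as choice functions (`sum_worst_le`).  The `+1` terms contribute
`∑_{q,m} τ(m)^B ≤ x^{ε₁} · C x^{1/2} (log x)^{c₂}`, negligible.
-/

noncomputable section

namespace Summit.Parity.GeneralizedHardyLittlewood.Theorems.EngineToPairs.TIOfBV

open Finset Real ArithmeticFunction

/-! ### Multiplicity of `d = qm` -/

/-- The multiplicity weight of a modulus `d ≥ 1`: `ν(d) = ∑_{(q, m) : qm = d} τ(m)^B ≤ τ(d)^{B+1}`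
(`τ(m) ≤ τ(d)` for `m ∣ d`, and `(q, m) ↦ m` is injective on the fibre, into the divisors of `d`).
[folklore] -/
theorem fiber_sum_tauPow_le (Qs Ms : Finset ℕ) (B : ℕ) {d : ℕ} (hd : 1 ≤ d) :
    ∑ p ∈ (Qs ×ˢ Ms).filter (fun p : ℕ × ℕ => p.1 * p.2 = d), tauPow B p.2 ≤ tauPow (B + 1) d := by
  have hd0 : d ≠ 0 := by omega
  set F := (Qs ×ˢ Ms).filter (fun p : ℕ × ℕ => p.1 * p.2 = d) with hF
  have hdvd : ∀ p ∈ F, p.2 ∣ d := fun p hp => by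
    obtain ⟨-, hpd⟩ := mem_filter.1 hp
    exact ⟨p.1, by rw [← hpd, mul_comm]⟩
  have hcard : #F ≤ #(Nat.divisors d) := by
    refine card_le_card_of_injOn Prod.snd (fun p hp => ?_) ?_
    · exact mem_coe.2 (Nat.mem_divisors.2 ⟨hdvd p hp, hd0⟩)
    · intro p₁ hp₁ p₂ hp₂ he
      have h₁ := (mem_filter.1 (mem_coe.1 hp₁)).2
      have h₂ := (mem_filter.1 (mem_coe.1 hp₂)).2
      have hs : 0 < p₁.2 := Nat.pos_of_ne_zero fun h0 => hd0 (by rw [← h₁, h0, mul_zero])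
      have he' : p₁.2 = p₂.2 := he
      refine Prod.ext (Nat.eq_of_mul_eq_mul_right hs ?_) he'
      rw [h₁, he', h₂]
  calc ∑ p ∈ F, tauPow B p.2 ≤ ∑ _p ∈ F, tauPow B d := by
        refine sum_le_sum fun p hp => ?_
        unfold tauPow
        exact pow_le_pow_left₀ (by positivity)
          (by exact_mod_cast card_le_card (Nat.divisors_subset_of_dvd hd0 (hdvd p hp))) B
    _ = #F * tauPow B d := by rw [sum_const, nsmul_eq_mul]
    _ ≤ (#(Nat.divisors d) : ℝ) * tauPow B d :=
        mul_le_mul_of_nonneg_right (by exact_mod_cast hcard) (tauPow_nonneg B d)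
    _ = tauPow (B + 1) d := by unfold tauPow; ring

/-- Regrouping `∑_{q ∈ Qs} ∑_{m ∈ Ms} f(m) g(qm)` by the value `d = qm ∈ T`. [folklore] -/
theorem sum_sum_eq_sum_fiber (Qs Ms T : Finset ℕ) (hmaps : ∀ q ∈ Qs, ∀ m ∈ Ms, q * m ∈ T)
    (f g : ℕ → ℝ) :
    ∑ q ∈ Qs, ∑ m ∈ Ms, f m * g (q * m) =
      ∑ d ∈ T, (∑ p ∈ (Qs ×ˢ Ms).filter (fun p : ℕ × ℕ => p.1 * p.2 = d), f p.2) * g d := by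
  have hprod : ∑ p ∈ Qs ×ˢ Ms, f p.2 * g (p.1 * p.2) = ∑ q ∈ Qs, ∑ m ∈ Ms, f m * g (q * m) :=
    sum_product _ _ _
  have hmaps' : ∀ p ∈ Qs ×ˢ Ms, p.1 * p.2 ∈ T := fun p hp =>
    hmaps _ (mem_product.1 hp).1 _ (mem_product.1 hp).2
  rw [← hprod, ← sum_fiberwise_of_maps_to hmaps']
  refine sum_congr rfl fun d _ => ?_
  rw [sum_mul]
  refine sum_congr rfl fun p hp => ?_
  rw [(mem_filter.1 hp).2]

/-! ### One application of `BVLiouville` with argmax choice functions -/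

/-- If the `BVLiouville` inequality holds at scale `x` and level `x^{1/2−ε}` with the bound `T` for ALL
residue and height choice functions, then for any admissible choice `d ↦ (c_d, N_d)` (`c_d < d`,
`N_d ≤ ⌊x/d⌋`) one has `∑_{d ≤ x^{1/2−ε}} |∑_{t=1}^{N_d} λ(dt + c_d)| ≤ T` (take the residue `c_d` and the
height `y_d = d · N_d ≤ x`). [this line] -/
theorem sum_worst_le {x ε T : ℝ} (hx : 0 ≤ x) {P : ℕ → ℕ × ℕ}
    (hP : ∀ d, 1 ≤ d → (P d).1 < d ∧ (P d).2 ≤ ⌊x / d⌋₊)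
    (hBVx : ∀ c : ℕ → ℤ, ∀ y : ℕ → ℝ, (∀ d, 1 ≤ d → 0 ≤ c d ∧ c d < d) → (∀ d, 0 ≤ y d ∧ y d ≤ x) →
      (∑ d ∈ Finset.Icc 1 ⌊x ^ (1 / 2 - ε)⌋₊, |∑ n ∈ Finset.Icc 1 ⌊y d / d⌋₊,
        (ArithmeticFunction.liouville (Int.toNat ((d : ℤ) * n + c d)) : ℝ)|) ≤ T) :
    ∑ d ∈ Icc 1 ⌊x ^ (1 / 2 - ε)⌋₊, |∑ t ∈ Icc 1 (P d).2, (liouville (d * t + (P d).1) : ℝ)| ≤ T := by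
  have h := hBVx (fun d => ((P d).1 : ℤ)) (fun d => (d : ℝ) * (P d).2) ?_ ?_
  · refine le_trans (le_of_eq (sum_congr rfl fun d hd => ?_)) h
    obtain ⟨hd1, -⟩ := mem_Icc.1 hd
    have hd0 : (d : ℝ) ≠ 0 := by exact_mod_cast (show d ≠ 0 by omega)
    have hfloor : ⌊(d : ℝ) * ((P d).2 : ℕ) / d⌋₊ = (P d).2 := by
      rw [mul_div_cancel_left₀ _ hd0, Nat.floor_natCast]
    have hcast : ∀ n : ℕ, Int.toNat ((d : ℤ) * n + ((P d).1 : ℤ)) = d * n + (P d).1 := fun n => by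
      have he : (d : ℤ) * n + ((P d).1 : ℤ) = ((d * n + (P d).1 : ℕ) : ℤ) := by push_cast; ring
      rw [he, Int.toNat_natCast]
    simp only [hfloor, hcast]
  · intro d hd
    exact ⟨by positivity, by exact_mod_cast (hP d hd).1⟩
  · intro d
    refine ⟨by positivity, ?_⟩
    rcases Nat.eq_zero_or_pos d with rfl | hd
    · simp [hx]
    · have hd0 : (0 : ℝ) < d := by exact_mod_cast hd
      have hN : ((P d).2 : ℝ) ≤ x / d :=
        le_trans (by exact_mod_cast (hP d hd).2) (Nat.floor_le (by positivity))
      calc (d : ℝ) * (P d).2 ≤ d * (x / d) := by gcongr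
        _ = x := by field_simp

end Summit.Parity.GeneralizedHardyLittlewood.Theorems.EngineToPairs.TIOfBV

/-! ### The stub -/

namespace Summit.Parity.GeneralizedHardyLittlewood.Theorems.EngineToPairs

open Finset Real ArithmeticFunction TIOfBV
open scoped ArithmeticFunction.sigma
open Literature.NumberTheory.Sieve (exists_sum_sigma_zero_pow_div_le_real exists_sum_sigma_zero_pow_le_real
  eventually_log_rpow_le_rpow)
open Summit.Parity.GeneralizedHardyLittlewood.Theses.LiouvilleShiftedTables (BVLiouville)

/-- **Stub S5 of line `Sketch`: the Type-I budget from Bombieri–Vinogradov for `λ`.**  For `h ≥ 1`,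
`0 < δ ≤ 1/4`, `0 < ε₁ ≤ δ`, every `B` and `A > 0` there are `C, x₀` with
`TypeIFam (moduliH h (x^{ε₁})) (shiftWeight h) x (1/2 − 2δ) B (C x (log x)^{−A})` for `x ≥ x₀`, assuming
`BVLiouville` (proved in the tree).  Proof: part 1 (`abs_inner_le`) bounds each inner sum by `2 G_x(qm) + 1`
with the worst pairs of `exists_worst`; regroup by `d = qm ≤ x^{1/2−δ}` with multiplicity
`ν(d) ≤ τ(d)^{B+1}`; Cauchy–Schwarz against the trivial bound `G_x(d) ≤ x/d` and
`∑ τ(d)^{2B+2}/d ≪ (log x)^{c₁}`; one application of `BVLiouville` at `ε = δ`, `A' = 2A + c₁` with the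
argmax choice functions; the `+1` terms contribute `≤ x^{ε₁} C x^{1/2} (log x)^{c₂}`. [this line] -/
theorem stub_TI_of_BV : BVLiouville → TIBudget := by
  intro hBV h _hh δ hδ hδ4 ε₁ hε₁ hε₁δ B A hA
  -- constants from the divisor power sums; `τ(m)^B` in the tree's notation
  obtain ⟨C₁, hC₁, hdiv⟩ := exists_sum_sigma_zero_pow_div_le_real (2 * B + 2)
  obtain ⟨C₂, hC₂, hτ⟩ := exists_sum_sigma_zero_pow_le_real B
  have htau : ∀ B' m : ℕ, tauPow B' m = (σ 0 m : ℝ) ^ B' := fun B' m => by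
    simp [tauPow, sigma_zero_apply]
  set c₁ : ℕ := 2 ^ (2 * B + 2 + 1) with hc₁
  set c₂ : ℕ := 2 ^ (B + 1) with hc₂
  -- one application of `BVLiouville` at `ε = δ`, `A' = 2A + c₁`
  obtain ⟨Cb, x₀, hbv⟩ := hBV δ hδ (2 * A + c₁) (by positivity)
  set Cb' : ℝ := max Cb 1 with hCb'
  have hCb'0 : 0 < Cb' := lt_of_lt_of_le one_pos (le_max_right _ _)
  set K : ℝ := Real.sqrt (C₁ * Cb') with hK
  have hK0 : 0 ≤ K := Real.sqrt_nonneg _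
  -- eventualities
  obtain ⟨x₁, hx₁⟩ := Filter.eventually_atTop.1
    ((Filter.eventually_ge_atTop (max x₀ (max 4 (2 * (h : ℝ))))).and
      ((Real.tendsto_log_atTop.eventually_ge_atTop (max C₂ 1)).and
        (eventually_log_rpow_le_rpow ((c₂ : ℝ) + A + 1) (by norm_num : (0 : ℝ) < 1 / 4))))
  refine ⟨2 * K + 1, x₁, fun x hx => ?_⟩
  obtain ⟨hxmax, hLC, hlog⟩ := hx₁ x hx
  have hx₀ : x₀ ≤ x := le_trans (le_max_left _ _) hxmax
  have hx4 : (4 : ℝ) ≤ x := le_trans (le_trans (le_max_left _ _) (le_max_right _ _)) hxmax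
  have hxh : 2 * (h : ℝ) ≤ x := le_trans (le_trans (le_max_right _ _) (le_max_right _ _)) hxmax
  have hx0 : 0 < x := by linarith
  have hx1 : (1 : ℝ) ≤ x := by linarith
  set L := Real.log x with hL
  have hL1 : 1 ≤ L := le_trans (le_max_right _ _) hLC
  have hL0 : 0 < L := by linarith
  have hC₂L : C₂ ≤ L := le_trans (le_max_left _ _) hLC
  set Qs := moduliH h (x ^ ε₁) with hQs
  set M := ⌊x ^ (1 / 2 - 2 * δ)⌋₊ with hM
  set D := ⌊x ^ (1 / 2 - δ)⌋₊ with hD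
  -- the worst residue and height per modulus at scale `x`
  obtain ⟨P, G, hGdef, hPmem, hGmax, hG0, hGle⟩ := exists_worst hx0.le
  intro I
  -- Step 1: the inner sums (part 1)
  have h1 : ∑ q ∈ Qs, ∑ m ∈ Icc 1 M, tauPow B m *
        |∑ n ∈ (Icc (I q m).1 (I q m).2).filter
            (fun n : ℕ => x / 2 < (m : ℝ) * n ∧ (m : ℝ) * n ≤ x), shiftWeight h q (m * n)| ≤
      2 * ∑ q ∈ Qs, ∑ m ∈ Icc 1 M, tauPow B m * G (q * m) + ∑ q ∈ Qs, ∑ m ∈ Icc 1 M, tauPow B m := by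
    rw [mul_sum, ← sum_add_distrib]
    refine sum_le_sum fun q hq => ?_
    rw [mul_sum, ← sum_add_distrib]
    refine sum_le_sum fun m hm => ?_
    obtain ⟨⟨hq1, -⟩, hqh⟩ := mem_moduliH.1 hq
    have hm1 : 1 ≤ m := (mem_Icc.1 hm).1
    have hin := abs_inner_le hqh hq1 hm1 hxh (I q m).1 (I q m).2 (hG0 (q * m))
      (hGmax (q * m) (Nat.mul_pos hq1 hm1))
    calc _ ≤ tauPow B m * (2 * G (q * m) + 1) := mul_le_mul_of_nonneg_left hin (tauPow_nonneg B m)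
      _ = _ := by ring
  -- Step 2: the `+1` terms are negligible
  have h2 : ∑ q ∈ Qs, ∑ m ∈ Icc 1 M, tauPow B m ≤ x / L ^ A := by
    rw [sum_const, nsmul_eq_mul]
    have hQcard : (#Qs : ℝ) ≤ x ^ (1 / 4 : ℝ) := by
      calc (#Qs : ℝ) ≤ #(Icc 1 ⌊x ^ ε₁⌋₊) := by exact_mod_cast card_le_card (filter_subset _ _)
        _ = ⌊x ^ ε₁⌋₊ := by simp
        _ ≤ x ^ ε₁ := Nat.floor_le (by positivity)
        _ ≤ x ^ (1 / 4 : ℝ) := Real.rpow_le_rpow_of_exponent_le hx1 (by linarith)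
    have hx2' : (2 : ℝ) ≤ x ^ (1 / 2 : ℝ) := by
      rw [← Real.sqrt_eq_rpow]
      calc (2 : ℝ) = Real.sqrt (2 ^ 2) := (Real.sqrt_sq (by norm_num)).symm
        _ ≤ Real.sqrt x := Real.sqrt_le_sqrt (by linarith)
    have hMsum : ∑ m ∈ Icc 1 M, tauPow B m ≤ C₂ * x ^ (1 / 2 : ℝ) * L ^ c₂ := by
      have hsub : Icc 1 M ⊆ Icc 1 ⌊x ^ (1 / 2 : ℝ)⌋₊ :=
        Icc_subset_Icc le_rfl (Nat.floor_le_floor (Real.rpow_le_rpow_of_exponent_le hx1 (by linarith)))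
      have hlog2 : Real.log (x ^ (1 / 2 : ℝ)) ≤ L := by
        rw [Real.log_rpow hx0]; linarith
      have hlog2' : 0 ≤ Real.log (x ^ (1 / 2 : ℝ)) := Real.log_nonneg (by linarith)
      calc ∑ m ∈ Icc 1 M, tauPow B m ≤ ∑ m ∈ Icc 1 ⌊x ^ (1 / 2 : ℝ)⌋₊, tauPow B m :=
            sum_le_sum_of_subset_of_nonneg hsub fun m _ _ => tauPow_nonneg B m
        _ = ∑ m ∈ Icc 1 ⌊x ^ (1 / 2 : ℝ)⌋₊, (σ 0 m : ℝ) ^ B := sum_congr rfl fun m _ => htau B m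
        _ ≤ C₂ * x ^ (1 / 2 : ℝ) * Real.log (x ^ (1 / 2 : ℝ)) ^ c₂ := hτ _ hx2'
        _ ≤ C₂ * x ^ (1 / 2 : ℝ) * L ^ c₂ := by gcongr
    have hLpow : L ^ ((c₂ : ℝ) + A + 1) = L ^ c₂ * L ^ A * L := by
      rw [Real.rpow_add hL0, Real.rpow_add hL0, Real.rpow_natCast, Real.rpow_one]
    have hxpow : x ^ (1 / 4 : ℝ) * x ^ (1 / 2 : ℝ) * x ^ (1 / 4 : ℝ) = x := by
      rw [← Real.rpow_add hx0, ← Real.rpow_add hx0]; norm_num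
    rw [le_div_iff₀ (by positivity)]
    calc (#Qs : ℝ) * (∑ m ∈ Icc 1 M, tauPow B m) * L ^ A
        ≤ x ^ (1 / 4 : ℝ) * (C₂ * x ^ (1 / 2 : ℝ) * L ^ c₂) * L ^ A := by
          gcongr
          exact sum_nonneg fun m _ => tauPow_nonneg B m
      _ ≤ x ^ (1 / 4 : ℝ) * (L * x ^ (1 / 2 : ℝ) * L ^ c₂) * L ^ A := by gcongr
      _ = x ^ (1 / 4 : ℝ) * x ^ (1 / 2 : ℝ) * L ^ ((c₂ : ℝ) + A + 1) := by rw [hLpow]; ring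
      _ ≤ x ^ (1 / 4 : ℝ) * x ^ (1 / 2 : ℝ) * x ^ (1 / 4 : ℝ) := by gcongr
      _ = x := hxpow
  -- Step 3: the main term — regroup by `d = qm`, Cauchy–Schwarz, `BVLiouville`
  have h3 : ∑ q ∈ Qs, ∑ m ∈ Icc 1 M, tauPow B m * G (q * m) ≤ K * x / L ^ A := by
    have hmaps : ∀ q ∈ Qs, ∀ m ∈ Icc 1 M, q * m ∈ Icc 1 D := by
      intro q hq m hm
      obtain ⟨⟨hq1, hqQ⟩, -⟩ := mem_moduliH.1 hq
      obtain ⟨hm1, hmM⟩ := mem_Icc.1 hm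
      refine mem_Icc.2 ⟨Nat.mul_pos hq1 hm1, Nat.le_floor ?_⟩
      push_cast
      calc (q : ℝ) * m ≤ x ^ ε₁ * x ^ (1 / 2 - 2 * δ) :=
            mul_le_mul (le_trans (by exact_mod_cast hqQ) (Nat.floor_le (by positivity)))
              (le_trans (by exact_mod_cast hmM) (Nat.floor_le (by positivity))) (by positivity)
              (by positivity)
        _ = x ^ (ε₁ + (1 / 2 - 2 * δ)) := (Real.rpow_add hx0 _ _).symm
        _ ≤ x ^ (1 / 2 - δ) := Real.rpow_le_rpow_of_exponent_le hx1 (by linarith)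
    rw [sum_sum_eq_sum_fiber Qs (Icc 1 M) (Icc 1 D) hmaps (tauPow B) G]
    set ν : ℕ → ℝ := fun d => ∑ p ∈ (Qs ×ˢ Icc 1 M).filter (fun p : ℕ × ℕ => p.1 * p.2 = d),
      tauPow B p.2 with hν
    have hν0 : ∀ d, 0 ≤ ν d := fun d => sum_nonneg fun p _ => tauPow_nonneg B p.2
    have hνle : ∀ d ∈ Icc 1 D, ν d ≤ tauPow (B + 1) d := fun d hd =>
      fiber_sum_tauPow_le _ _ B (mem_Icc.1 hd).1
    -- Cauchy–Schwarz
    have hCS : ∑ d ∈ Icc 1 D, ν d * G d ≤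
        Real.sqrt (∑ d ∈ Icc 1 D, ν d ^ 2 * G d) * Real.sqrt (∑ d ∈ Icc 1 D, G d) := by
      have hcs := Real.sum_mul_le_sqrt_mul_sqrt (Icc 1 D) (fun d => ν d * Real.sqrt (G d))
        (fun d => Real.sqrt (G d))
      have e1 : ∑ d ∈ Icc 1 D, ν d * Real.sqrt (G d) * Real.sqrt (G d) = ∑ d ∈ Icc 1 D, ν d * G d :=
        sum_congr rfl fun d _ => by rw [mul_assoc, Real.mul_self_sqrt (hG0 d)]
      have e2 : ∑ d ∈ Icc 1 D, (ν d * Real.sqrt (G d)) ^ 2 = ∑ d ∈ Icc 1 D, ν d ^ 2 * G d :=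
        sum_congr rfl fun d _ => by rw [mul_pow, Real.sq_sqrt (hG0 d)]
      have e3 : ∑ d ∈ Icc 1 D, Real.sqrt (G d) ^ 2 = ∑ d ∈ Icc 1 D, G d :=
        sum_congr rfl fun d _ => by rw [Real.sq_sqrt (hG0 d)]
      rwa [e1, e2, e3] at hcs
    -- first factor: trivial bound and divisor power sums
    have hA1 : ∑ d ∈ Icc 1 D, ν d ^ 2 * G d ≤ C₁ * x * L ^ c₁ := by
      have hDx : Icc 1 D ⊆ Icc 1 ⌊x⌋₊ := by
        refine Icc_subset_Icc le_rfl (Nat.floor_le_floor ?_)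
        calc x ^ (1 / 2 - δ) ≤ x ^ (1 : ℝ) := Real.rpow_le_rpow_of_exponent_le hx1 (by linarith)
          _ = x := Real.rpow_one x
      calc ∑ d ∈ Icc 1 D, ν d ^ 2 * G d
          ≤ ∑ d ∈ Icc 1 D, x * ((σ 0 d : ℝ) ^ (2 * B + 2) / d) := by
            refine sum_le_sum fun d hd => ?_
            have hd1 := (mem_Icc.1 hd).1
            calc ν d ^ 2 * G d ≤ tauPow (B + 1) d ^ 2 * (x / d) :=
                  mul_le_mul (pow_le_pow_left₀ (hν0 d) (hνle d hd) 2) (hGle d hd1) (hG0 d)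
                    (by positivity)
              _ = x * ((σ 0 d : ℝ) ^ (2 * B + 2) / d) := by
                  rw [htau, ← pow_mul, show (B + 1) * 2 = 2 * B + 2 by ring]; ring
        _ ≤ ∑ d ∈ Icc 1 ⌊x⌋₊, x * ((σ 0 d : ℝ) ^ (2 * B + 2) / d) :=
            sum_le_sum_of_subset_of_nonneg hDx fun d _ _ => by positivity
        _ = x * ∑ d ∈ Icc 1 ⌊x⌋₊, (σ 0 d : ℝ) ^ (2 * B + 2) / d := (mul_sum _ _ _).symm
        _ ≤ x * (C₁ * L ^ c₁) := mul_le_mul_of_nonneg_left (hdiv x (by linarith)) hx0.le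
        _ = C₁ * x * L ^ c₁ := by ring
    -- second factor: `BVLiouville` with the argmax choice functions
    have hA2 : ∑ d ∈ Icc 1 D, G d ≤ Cb' * x / L ^ (2 * A + c₁) := by
      rw [sum_congr rfl fun d _ => hGdef d]
      refine (sum_worst_le hx0.le hPmem (hbv x hx₀)).trans ?_
      exact div_le_div_of_nonneg_right (mul_le_mul_of_nonneg_right (le_max_left _ _) hx0.le)
        (by positivity)
    -- combine
    have hprod : C₁ * x * L ^ c₁ * (Cb' * x / L ^ (2 * A + c₁)) = (K * x / L ^ A) ^ 2 := by
      rw [hK, div_pow, mul_pow, Real.sq_sqrt (by positivity), Real.rpow_add hL0, two_mul,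
        Real.rpow_add hL0, Real.rpow_natCast]
      field_simp
    calc ∑ d ∈ Icc 1 D, ν d * G d
        ≤ Real.sqrt (∑ d ∈ Icc 1 D, ν d ^ 2 * G d) * Real.sqrt (∑ d ∈ Icc 1 D, G d) := hCS
      _ ≤ Real.sqrt (C₁ * x * L ^ c₁) * Real.sqrt (Cb' * x / L ^ (2 * A + c₁)) := by gcongr
      _ = Real.sqrt ((K * x / L ^ A) ^ 2) := by rw [← Real.sqrt_mul (by positivity), hprod]
      _ = K * x / L ^ A := Real.sqrt_sq (by positivity)
  -- conclusion
  refine h1.trans ?_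
  have hsplit : (2 * K + 1) * x / L ^ A = 2 * (K * x / L ^ A) + x / L ^ A := by ring
  rw [hsplit]
  linarith [h2, h3]

end Summit.Parity.GeneralizedHardyLittlewood.Theorems.EngineToPairs

end
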